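import Literature.Topology.PlanarFoliations.DartEdge
import Literature.Topology.PlanarFoliations.StarGateBand
import HarnessLib

/-!
# Fences over walks of the separatrix graph

Topic: Topology / PlanarFoliations, sequel to `StarGate.lean`, `StarGateBand.lean`,
`DartEdge.lean`. A **walk** of the separatrix graph of star data `D` is given by a sequence of
**junctions** `J k` (a saddle puncture `v`, an incoming and an outgoing prong `jin`, `jout`, a
parameter `β` and prong boxes at the two prong points) and leafwise paths `ℓ k` of the planar
foliation from the outgoing prong point of `J k` to the incoming prong point of `J (k + 1)`
(arcs of separatrices). **Over the image under `g` of the walk up to the junction `n` there is a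
fence of the ambient foliation `T`** (`StarData.walkFence`), at the level
`τ₀ = level v₀ v₀`, starting from the height germ of the flow box of `v₀` with initial vertical on
its plaques (the normal form required by the transport of null-homotopy,
`TautFoliationsNullTransportM.lean`), ending on the star vertical of the junction `n` converted by
an order isomorphism `χₙ` of the levels; and **on the side `s = ±1` of the base level on which the
planar leaves turn from `jin k` to `jout k` at every junction, its horizontals are images of planar
leaf arcs**: the horizontal at level `τ` is `g ∘ ι ∘ Ψ(·, τ)` for a path `Ψ(·, τ)` of `X`
continuous in the leaf topology of the planar foliation, from the point over `pt jin₀ (β₀, χ₀ τ)`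
to the point over `pt jinₙ (βₙ, χₙ τ)` — the planar leaf tracking the walk. The fence is assembled
by concatenation (`IsFenceOn.trans`) from the gate fences at the junctions (`StarGate`) and the
edge fences (`DartEdge`), the planar description from theirs (`StarGateBand`, `DartEdge`).

* `StarData.WalkJunction` (**structure**), `WalkJunction.turn`, `WalkJunction.τ₀`,
  `WalkJunction.χ₀`, `WalkJunction.start`, `WalkJunction.gateBase`, `StarData.walkBase`
  (**definitions**; the last two describe the base horizontal of the fence pointwise: prong in,
  the puncture, prong out, then the image of the link);
* `StarData.WalkFenceData` (**structure**): the data (`χ, ε, Γ, Φ, Ψ`) and properties of a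
  walk fence up to the junction `n`; `StarData.walkFence` (**definition**, by recursion:
  `WalkFenceData.zero` = the degenerate sector fence at the first prong point,
  `WalkFenceData.succ` = concatenation with the gate fence of `J n` and the chosen edge fence
  over `ℓ n`, `StarData.walkFence_step` **proved**) — a definition rather than an existence
  statement, so that later files can prove further properties of the same fence by induction;
* `StarData.walkFence_start` (**proved**): the normal form at the start.

## References

* C. Camacho, A. Lins Neto, *Geometric Theory of Foliations*, Birkhäuser (1985), Ch. VII §2
  [CamachoLinsNeto1985].
* I. Tamura, *Topology of Foliations*, AMS (1992), §25 [Tamura1992].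
-/

noncomputable section

open Set Filter Function Metric unitInterval
open _root_.Topology
open Literature.Topology.FourManifolds Literature.Topology.FourManifolds.Foliation

namespace Literature.Topology.PlanarFoliations

variable {X : Type*} [TopologicalSpace X] [Nonempty X] {F : Foliation ℝ X} {ι : X → ℂ}
variable {B : Type*} [NormedAddCommGroup B] {M : Type*} [TopologicalSpace M] {T : Foliation B M} {g : ℂ → M}

/-! ## Two elementary lemmas on order isomorphisms of the levels -/

/-- An order isomorphism of `ℝ` vanishing at `τ₀` maps a neighbourhood of `τ₀` into `[-ρ, ρ]`.
[folklore] -/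
theorem exists_forall_orderIso_mem_Icc (χ : ℝ ≃o ℝ) {τ₀ : ℝ} (hχ : χ τ₀ = 0) {ρ : ℝ} (hρ : 0 < ρ) :
    ∃ η > (0 : ℝ), ∀ τ ∈ Ioo (τ₀ - η) (τ₀ + η), χ τ ∈ Icc (-ρ) ρ := by
  have h : ∀ᶠ τ in 𝓝 τ₀, χ τ ∈ Ioo (-ρ) ρ :=
    χ.continuous.continuousAt.preimage_mem_nhds (by rw [hχ]; exact Ioo_mem_nhds (by linarith) hρ)
  obtain ⟨η, hη, hsub⟩ := IsHomeoGermAt.exists_Ioo_subset_of_mem_nhds h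
  exact ⟨η, hη, fun τ hτ ↦ Ioo_subset_Icc_self (hsub hτ)⟩

/-- An order isomorphism of `ℝ` vanishing at `τ₀` has the strict sign of `τ - τ₀`. [folklore] -/
theorem orderIso_sign (χ : ℝ ≃o ℝ) {τ₀ : ℝ} (hχ : χ τ₀ = 0) {s : ℝ} (hs : s = 1 ∨ s = -1) {τ : ℝ}
    (hτ : 0 < s * (τ - τ₀)) : 0 < s * χ τ ∧ χ τ ≠ 0 := by
  rcases hs with rfl | rfl
  · have h : τ₀ < τ := by linarith
    have h' := χ.strictMono h
    rw [hχ] at h'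
    exact ⟨by linarith, h'.ne'⟩
  · have h : τ < τ₀ := by linarith
    have h' := χ.strictMono h
    rw [hχ] at h'
    exact ⟨by linarith, h'.ne⟩

namespace StarData

variable (D : StarData F ι T g) (hι : IsOpenEmbedding ι)

/-! ## Junctions -/

/-- **A junction of a walk**: a saddle puncture `v`, an incoming prong `jin`, an outgoing prong
`jout`, a parameter `β ∈ [0, ρ]` and prong boxes at the two prong points `pt jin (β, 0)`,
`pt jout (β, 0)`. [folklore] -/
structure WalkJunction where
  /-- the puncture -/
  v : ℂ
  hv : D.nprong v ≠ 0
  /-- the incoming prong -/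
  jin : ZMod (D.nprong v)
  /-- the outgoing prong -/
  jout : ZMod (D.nprong v)
  /-- the parameter of the prong points -/
  β : ℝ
  hβ : β ∈ Icc 0 (D.star v hv).ρ
  /-- the prong box at the incoming prong point -/
  Kin : ProngBox (D.star v hv) hι jin β
  /-- the prong box at the outgoing prong point -/
  Kout : ProngBox (D.star v hv) hι jout β

variable {D hι}

namespace WalkJunction

/-- **The turn of the planar leaves on the side `s`** at the junction: from `jin` to `jin + 1` if
`0 ≤ sg jin * s`, else to `jin - 1` (the neighbour `ProngStar.nb jin h` at the heights `h` of
sign `s`). [folklore] -/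
def turn (J₀ : D.WalkJunction hι) (s : ℝ) : ZMod (D.nprong J₀.v) :=
  if 0 ≤ (D.star J₀.v J₀.hv).sg J₀.jin * s then J₀.jin + 1 else J₀.jin - 1

/-- At a height `h` of strict sign `s = ±1`, the neighbour of `jin` is the turn on the side `s`.
[folklore] -/
theorem nb_eq_turn (J₀ : D.WalkJunction hι) {s h : ℝ} (hs : s = 1 ∨ s = -1) (hh : 0 < s * h) :
    (D.star J₀.v J₀.hv).nb J₀.jin h = J₀.turn s := by
  unfold ProngStar.nb turn
  have hsg := (D.star J₀.v J₀.hv).sg_sq J₀.jin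
  rcases hs with rfl | rfl <;> rcases hsg with hsg | hsg <;> rw [hsg]
  · rw [if_pos (by linarith), if_pos (by norm_num)]
  · rw [if_neg (not_le.2 (by linarith)), if_neg (not_le.2 (by norm_num))]
  · rw [if_neg (not_le.2 (by linarith)), if_neg (not_le.2 (by norm_num))]
  · rw [if_pos (by linarith), if_pos (by norm_num)]

/-- **The base level** of a walk starting at the junction: the level of its puncture. [folklore] -/
def τ₀ (J₀ : D.WalkJunction hι) : ℝ := D.level J₀.v J₀.v

/-- **The initial level conversion** of a walk starting at the junction: `Λ⁻¹`. [folklore] -/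
def χ₀ (J₀ : D.WalkJunction hι) : ℝ ≃o ℝ := (D.levelIso J₀.hv).symm

/-- **The initial germ** of a walk starting at the junction: the junction germ at the incoming
prong point. [folklore] -/
def start (J₀ : D.WalkJunction hι) : T.GermSpace :=
  D.sectorGerm J₀.hv J₀.jin J₀.β J₀.β J₀.χ₀ J₀.τ₀ 0

/-- `χ₀ τ₀ = 0`. [folklore] -/
theorem χ₀_τ₀ (J₀ : D.WalkJunction hι) : J₀.χ₀ J₀.τ₀ = 0 := by
  show (D.levelIso J₀.hv).symm (D.level J₀.v J₀.v) = 0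
  rw [← D.levelIso_zero J₀.hv, OrderIso.symm_apply_apply]

/-- `Λ (χ₀ τ) = τ`. [folklore] -/
theorem gateIso_χ₀ (J₀ : D.WalkJunction hι) (τ : ℝ) : D.gateIso J₀.hv J₀.χ₀ τ = τ :=
  (D.levelIso J₀.hv).apply_symm_apply τ

/-- **The initial germ of a walk is the height germ of the flow box of its first puncture.**
[folklore] -/
theorem start_germ (J₀ : D.WalkJunction hι) : J₀.start.germ = ↑(height (D.box J₀.v)) := by
  rw [start, sectorGerm, germSection_germ]
  have hfun : ((D.gateIso J₀.hv J₀.χ₀).symm ∘ height (D.box J₀.v) : M → ℝ) = height (D.box J₀.v) := by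
    funext w
    simp only [comp_apply]
    have h := J₀.gateIso_χ₀ ((D.gateIso J₀.hv J₀.χ₀).symm (height (D.box J₀.v) w))
    rw [OrderIso.apply_symm_apply] at h
    exact h.symm
  rw [hfun]

/-- The base point of the initial germ of a walk lies on the plaque of the base level. [folklore] -/
theorem start_pt_mem (J₀ : D.WalkJunction hι) : ofLeafSpace J₀.start.pt ∈ plaque (D.box J₀.v) J₀.τ₀ := by
  rw [start, sectorGerm, germSection_pt, ofLeafSpace_leafPlaqueMap, J₀.gateIso_χ₀]
  exact T.plaqueMap_mem_plaque (D.box_mem J₀.v (D.mem_P _ J₀.hv)) _ _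

/-- **The base horizontal of the gate** (level-free): the prong `jin` from `pt jin (β, 0)` to the
puncture, the puncture, the prong `jout` from the puncture to `pt jout (β, 0)`, in `M`.
[folklore] -/
def gateBase (J₀ : D.WalkJunction hι) : I → M :=
  transFun (transFun (fun θ ↦ g ((D.star J₀.v J₀.hv).pt J₀.jin (βline J₀.β 0 θ, 0))) (fun _ ↦ g J₀.v))
    (fun θ ↦ g ((D.star J₀.v J₀.hv).pt J₀.jout (βline 0 J₀.β θ, 0)))

variable [NormedSpace ℝ B] in
/-- **At the base level the gate fence is the base horizontal of the gate.** [folklore] -/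
theorem gateFence_base (J₀ : D.WalkJunction hι) (χ : ℝ ≃o ℝ) {τ₀ : ℝ} (hχ : χ τ₀ = 0) (θ : I) :
    D.gateFence J₀.hv J₀.jin J₀.jout J₀.β χ θ τ₀ = J₀.gateBase θ := by
  rw [gateBase, gateFence]
  simp only [transFence_apply_eq_transFun]
  have hvP : J₀.v ∈ D.P := D.mem_P _ J₀.hv
  refine transFun_congr (fun θ' ↦ transFun_congr (fun θ'' ↦ ?_) (fun θ'' ↦ ?_) θ') (fun θ' ↦ ?_) θ
  · show g ((D.star J₀.v J₀.hv).pt J₀.jin (βline J₀.β 0 θ'', χ τ₀)) = g ((D.star J₀.v J₀.hv).pt J₀.jin (βline J₀.β 0 θ'', 0))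
    rw [hχ]
  · -- the slide at the base level is constant, equal to `g v`
    show slideFence (D.box J₀.v) (D.gateIso J₀.hv χ) (D.gateT₁ J₀.hv J₀.jin χ) (D.gateT₂ J₀.hv J₀.jout χ) θ'' τ₀ = g J₀.v
    have h1 : D.gateT₁ J₀.hv J₀.jin χ τ₀ = g J₀.v := by rw [gateT₁, hχ, Prod.mk_zero_zero, ProngStar.pt_zero]
    have h2 : D.gateT₂ J₀.hv J₀.jout χ τ₀ = g J₀.v := by rw [gateT₂, hχ, Prod.mk_zero_zero, ProngStar.pt_zero]
    have hpl : D.gateT₁ J₀.hv J₀.jin χ τ₀ ∈ plaque (D.box J₀.v) (D.gateIso J₀.hv χ τ₀) := by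
      rw [h1, mem_plaque_iff, gateIso_apply, hχ, levelIso_zero]
      exact ⟨D.mapsTo_ball J₀.v hvP (mem_ball_self (D.rad_pos J₀.v hvP)), rfl⟩
    rw [slideFence_apply_of_eq (h1.trans h2.symm) hpl, h1]
  · show g ((D.star J₀.v J₀.hv).pt J₀.jout (βline 0 J₀.β θ', χ τ₀)) = g ((D.star J₀.v J₀.hv).pt J₀.jout (βline 0 J₀.β θ', 0))
    rw [hχ]

end WalkJunction

/-- **The base horizontal of the walk fence** (level-free, in `M`): the constant at the incoming
prong point of `J 0`, then for each `k < n` the base horizontal of the gate of `J k` and the image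
under `g ∘ ι` of the link `ℓ k` (with constant ends). [folklore] -/
def walkBase (D : StarData F ι T g) (J : ℕ → D.WalkJunction hι) (ℓ : ∀ k, Path (J k).Kout.base (J (k + 1)).Kin.base) :
    ℕ → I → M
  | 0 => fun _ ↦ g ((D.star (J 0).v (J 0).hv).pt (J 0).jin ((J 0).β, 0))
  | n + 1 => transFun (transFun (walkBase D J ℓ n) (J n).gateBase)
      (fun θ ↦ g (ι (transFun (transFun (fun _ ↦ (J n).Kout.base) (ℓ n)) (fun _ ↦ (J (n + 1)).Kin.base) θ)))

/-! ## Chosen radii -/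

/-- A level radius on which the conversion `χ` stays in `[-ρ, ρ]` (chosen). [folklore] -/
def icRadius (D : StarData F ι T g) {v : ℂ} (hv : D.nprong v ≠ 0) (χ : ℝ ≃o ℝ) {τ₀ : ℝ} (hχ : χ τ₀ = 0) : ℝ :=
  (exists_forall_orderIso_mem_Icc χ hχ (D.star v hv).ρ_pos).choose

omit [Nonempty X] in
/-- The chosen level radius is positive. [folklore] -/
theorem icRadius_pos {v : ℂ} (hv : D.nprong v ≠ 0) (χ : ℝ ≃o ℝ) {τ₀ : ℝ} (hχ : χ τ₀ = 0) : 0 < D.icRadius hv χ hχ :=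
  (exists_forall_orderIso_mem_Icc χ hχ (D.star v hv).ρ_pos).choose_spec.1

omit [Nonempty X] in
/-- On the chosen level radius the conversion stays in `[-ρ, ρ]`. [folklore] -/
theorem icRadius_spec {v : ℂ} (hv : D.nprong v ≠ 0) (χ : ℝ ≃o ℝ) {τ₀ : ℝ} (hχ : χ τ₀ = 0) :
    ∀ τ ∈ Ioo (τ₀ - D.icRadius hv χ hχ) (τ₀ + D.icRadius hv χ hχ), χ τ ∈ Icc (-(D.star v hv).ρ) (D.star v hv).ρ :=
  (exists_forall_orderIso_mem_Icc χ hχ (D.star v hv).ρ_pos).choose_spec.2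

/-- A level radius for the star vertical of a prong box (chosen, `ProngBox.exists_radius`).
[folklore] -/
def _root_.Literature.Topology.PlanarFoliations.ProngBox.radius {v : ℂ} {n : ℕ} {P : ProngStar F ι v n}
    {hι : IsOpenEmbedding ι} {j : ZMod n} {β : ℝ} (K : ProngBox P hι j β) (hβ : β ∈ Icc 0 P.ρ) (χ : ℝ ≃o ℝ)
    {τ₀ : ℝ} (hχ₀ : χ τ₀ = 0) : ℝ :=
  (K.exists_radius hβ χ hχ₀).choose

/-- The chosen radius is positive. [folklore] -/
theorem _root_.Literature.Topology.PlanarFoliations.ProngBox.radius_pos {v : ℂ} {n : ℕ} {P : ProngStar F ι v n}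
    {hι : IsOpenEmbedding ι} {j : ZMod n} {β : ℝ} (K : ProngBox P hι j β) (hβ : β ∈ Icc 0 P.ρ) (χ : ℝ ≃o ℝ)
    {τ₀ : ℝ} (hχ₀ : χ τ₀ = 0) : 0 < K.radius hβ χ hχ₀ :=
  (K.exists_radius hβ χ hχ₀).choose_spec.1

/-- On the chosen radius the star vertical has coordinates in the half square, lies in the ball of
the box and its lift lies in `U`. [folklore] -/
theorem _root_.Literature.Topology.PlanarFoliations.ProngBox.radius_spec {v : ℂ} {n : ℕ} {P : ProngStar F ι v n}
    {hι : IsOpenEmbedding ι} {j : ZMod n} {β : ℝ} (K : ProngBox P hι j β) (hβ : β ∈ Icc 0 P.ρ) (χ : ℝ ≃o ℝ)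
    {τ₀ : ℝ} (hχ₀ : χ τ₀ = 0) :
    ∀ τ ∈ Ioo (τ₀ - K.radius hβ χ hχ₀) (τ₀ + K.radius hβ χ hχ₀),
      (β, χ τ) ∈ P.rect ∧ P.pt j (β, χ τ) ∈ ball (P.pt j (β, 0)) K.r ∧ K.T₁ χ τ ∈ K.U :=
  (K.exists_radius hβ χ hχ₀).choose_spec.2

/-! ## The fence over the empty walk -/

namespace WalkJunction

/-- The level radius of the fence over the empty walk at the junction. [folklore] -/
def baseRadius (J₀ : D.WalkJunction hι) : ℝ :=
  min (D.icRadius J₀.hv J₀.χ₀ J₀.χ₀_τ₀) (J₀.Kin.radius J₀.hβ J₀.χ₀ J₀.χ₀_τ₀)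

/-- The level radius is positive. [folklore] -/
theorem baseRadius_pos (J₀ : D.WalkJunction hι) : 0 < J₀.baseRadius :=
  lt_min (D.icRadius_pos J₀.hv J₀.χ₀ J₀.χ₀_τ₀) (J₀.Kin.radius_pos J₀.hβ J₀.χ₀ J₀.χ₀_τ₀)

/-- On the level radius, `χ₀ τ ∈ [-ρ, ρ]`. [folklore] -/
theorem χ₀_mem (J₀ : D.WalkJunction hι) {τ : ℝ} (hτ : τ ∈ Ioo (J₀.τ₀ - J₀.baseRadius) (J₀.τ₀ + J₀.baseRadius)) :
    J₀.χ₀ τ ∈ Icc (-(D.star J₀.v J₀.hv).ρ) (D.star J₀.v J₀.hv).ρ := by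
  have h₁ : J₀.baseRadius ≤ D.icRadius J₀.hv J₀.χ₀ J₀.χ₀_τ₀ := min_le_left _ _
  exact D.icRadius_spec J₀.hv J₀.χ₀ J₀.χ₀_τ₀ τ ⟨by linarith [hτ.1], by linarith [hτ.2]⟩

/-- On the level radius, the radius data of the incoming prong box hold for `χ₀`. [folklore] -/
theorem radius_spec₀ (J₀ : D.WalkJunction hι) {τ : ℝ} (hτ : τ ∈ Ioo (J₀.τ₀ - J₀.baseRadius) (J₀.τ₀ + J₀.baseRadius)) :
    (J₀.β, J₀.χ₀ τ) ∈ (D.star J₀.v J₀.hv).rect ∧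
      (D.star J₀.v J₀.hv).pt J₀.jin (J₀.β, J₀.χ₀ τ) ∈ ball ((D.star J₀.v J₀.hv).pt J₀.jin (J₀.β, 0)) J₀.Kin.r ∧
      J₀.Kin.T₁ J₀.χ₀ τ ∈ J₀.Kin.U := by
  have h₁ : J₀.baseRadius ≤ J₀.Kin.radius J₀.hβ J₀.χ₀ J₀.χ₀_τ₀ := min_le_right _ _
  exact J₀.Kin.radius_spec J₀.hβ J₀.χ₀ J₀.χ₀_τ₀ τ ⟨by linarith [hτ.1], by linarith [hτ.2]⟩

/-- The end of the degenerate sector germ path is the junction germ with parameters `β, 0`.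
[folklore] -/
theorem sectorGerm_end (J₀ : D.WalkJunction hι) :
    D.sectorGerm J₀.hv J₀.jin J₀.β 0 J₀.χ₀ J₀.τ₀ 0 = D.sectorGerm J₀.hv J₀.jin J₀.β J₀.β J₀.χ₀ J₀.τ₀ 1 := by
  unfold sectorGerm; rw [βline_one, βline_zero]

/-- **The germ path of the fence over the empty walk**: the degenerate sector germ path.
[folklore] -/
def basePath (J₀ : D.WalkJunction hι) : Path J₀.start (D.sectorGerm J₀.hv J₀.jin J₀.β 0 J₀.χ₀ J₀.τ₀ 0) :=
  (D.sectorPath J₀.hv J₀.jin J₀.hβ J₀.hβ J₀.χ₀ J₀.τ₀).cast rfl J₀.sectorGerm_end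

/-- **The fence over the empty walk**: the degenerate sector fence (all horizontals constant).
[folklore] -/
def baseFence (J₀ : D.WalkJunction hι) : I → ℝ → M := D.sectorFence J₀.hv J₀.jin J₀.β J₀.β J₀.χ₀

/-- The fence over the empty walk is a fence. [folklore] -/
theorem isFenceOn_base (J₀ : D.WalkJunction hι) : IsFenceOn T J₀.basePath J₀.τ₀ J₀.baseRadius J₀.baseFence univ :=
  D.isFenceOn_sectorFence J₀.hv (j := J₀.jin) J₀.baseRadius_pos J₀.χ₀_τ₀ (fun _ hτ ↦ J₀.χ₀_mem hτ) J₀.hβ J₀.hβ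

/-- The fence over the empty walk is the star vertical, at every `θ`. [folklore] -/
theorem baseFence_apply (J₀ : D.WalkJunction hι) (θ : I) (τ : ℝ) :
    J₀.baseFence θ τ = g ((D.star J₀.v J₀.hv).pt J₀.jin (J₀.β, J₀.χ₀ τ)) := by
  have hββ : βline J₀.β J₀.β θ = J₀.β := by unfold βline; ring
  rw [baseFence, sectorFence, hββ]

/-- The initial vertical of the fence over the empty walk runs on the plaques of `box v`.
[folklore] -/
theorem baseFence_mem_plaque (J₀ : D.WalkJunction hι) {τ : ℝ}
    (hτ : τ ∈ Ioo (J₀.τ₀ - J₀.baseRadius) (J₀.τ₀ + J₀.baseRadius)) : J₀.baseFence 0 τ ∈ plaque (D.box J₀.v) τ := by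
  have hrect : ((J₀.β, J₀.χ₀ τ) : ℝ × ℝ) ∈ (D.star J₀.v J₀.hv).rect :=
    ((D.star J₀.v J₀.hv).mem_rect_iff).2 ⟨J₀.hβ, J₀.χ₀_mem hτ⟩
  rw [baseFence_apply, mem_plaque_iff]
  refine ⟨D.mapsTo_S J₀.hv J₀.jin ((D.star J₀.v J₀.hv).pt_mem hrect), ?_⟩
  show D.level J₀.v ((D.star J₀.v J₀.hv).pt J₀.jin (J₀.β, J₀.χ₀ τ)) = τ
  rw [D.level_pt_eq_levelIso J₀.hv J₀.jin hrect]
  exact (D.levelIso J₀.hv).apply_symm_apply τ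

/-- On the level radius, the star vertical of the incoming prong box lies over `pt jin (β, χ₀ τ)`.
[folklore] -/
theorem ι_T₁_χ₀ (J₀ : D.WalkJunction hι) {τ : ℝ} (hτ : τ ∈ Ioo (J₀.τ₀ - J₀.baseRadius) (J₀.τ₀ + J₀.baseRadius)) :
    ι (J₀.Kin.T₁ J₀.χ₀ τ) = (D.star J₀.v J₀.hv).pt J₀.jin (J₀.β, J₀.χ₀ τ) :=
  ProngStar.ι_lift hι ((D.star J₀.v J₀.hv).ball_subset_range J₀.Kin.ball_subset (J₀.radius_spec₀ hτ).2.1)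

end WalkJunction

/-! ## The step: one more junction and edge -/

variable [NormedSpace ℝ B]

/-- **The step of the walk fence.** Given a fence from `d₀` ending on the star vertical of the
incoming prong point of the junction `Ja` (converted by `χa`), whose horizontals on the side `s`
are images of planar leaf paths ending at the points of that star vertical, and an edge fence
`E` over a link `ℓ` from the outgoing prong point of `Ja`, where `Ja` turns to the side `s`: the
concatenation with the gate fence of `Ja` and `E` is a fence from `d₀` ending on the star vertical
of the target prong box, with the same initial vertical, the same planar description on the side
`s`, and the expected base horizontal. [cite: CamachoLinsNeto1985, Ch. VII §2] -/
theorem walkFence_step {s : ℝ} (hs : s = 1 ∨ s = -1) {τ₀ : ℝ} {d₀ : T.GermSpace} (Ja Jb : D.WalkJunction hι)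
    (hturn : Ja.jout = Ja.turn s) (ℓ : Path Ja.Kout.base Jb.Kin.base) (χa : ℝ ≃o ℝ) (hχa : χa τ₀ = 0) {ε : ℝ}
    (hε : 0 < ε) (Γ : Path d₀ (D.sectorGerm Ja.hv Ja.jin Ja.β 0 χa τ₀ 0)) {Φ : I → ℝ → M} {Ψ : I → ℝ → X}
    (hΦ : IsFenceOn T Γ τ₀ ε Φ univ)
    (hΦ1 : ∀ τ ∈ Ioo (τ₀ - ε) (τ₀ + ε), Φ 1 τ = g ((D.star Ja.v Ja.hv).pt Ja.jin (Ja.β, χa τ)))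
    (htrack : ∀ τ ∈ Ioo (τ₀ - ε) (τ₀ + ε), 0 < s * (τ - τ₀) →
      (∀ θ, Φ θ τ = g (ι (Ψ θ τ))) ∧ Continuous (toLeafSpace ∘ fun θ ↦ Ψ θ τ : I → F.LeafSpace) ∧
        Ψ 1 τ = Ja.Kin.T₁ χa τ)
    (E : D.EdgeFence hι Ja.hv Ja.Kout Jb.hv Jb.Kin ℓ χa τ₀) :
    let εc : ℝ := min ε (min (D.icRadius Ja.hv χa hχa / 4) E.ε)
    let Φ' : I → ℝ → M := transFence (transFence Φ (D.gateFence Ja.hv Ja.jin Ja.jout Ja.β χa)) E.Φ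
    let Ψ' : I → ℝ → X := transFence (transFence Ψ (D.gateΨ hι Ja.hv Ja.jin Ja.jout Ja.β χa)) E.Ψ
    0 < εc / 4 ∧ εc / 4 ≤ ε ∧
      IsFenceOn T ((Γ.trans (D.gatePath Ja.hv hχa Ja.hβ)).trans E.Γ) τ₀ (εc / 4) Φ' univ ∧
      (∀ τ, Φ' 0 τ = Φ 0 τ) ∧ (∀ τ, Ψ' 0 τ = Ψ 0 τ) ∧
      (∀ τ ∈ Ioo (τ₀ - εc / 4) (τ₀ + εc / 4), Φ' 1 τ = g ((D.star Jb.v Jb.hv).pt Jb.jin (Jb.β, E.χ' τ))) ∧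
      (∀ τ ∈ Ioo (τ₀ - εc / 4) (τ₀ + εc / 4), 0 < s * (τ - τ₀) →
        (∀ θ, Φ' θ τ = g (ι (Ψ' θ τ))) ∧ Continuous (toLeafSpace ∘ fun θ ↦ Ψ' θ τ : I → F.LeafSpace) ∧
        Ψ' 1 τ = Jb.Kin.T₁ E.χ' τ ∧ ι (Jb.Kin.T₁ E.χ' τ) = (D.star Jb.v Jb.hv).pt Jb.jin (Jb.β, E.χ' τ)) ∧
      (∀ θ, Φ' θ τ₀ = transFun (transFun (fun θ ↦ Φ θ τ₀) Ja.gateBase)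
        (fun θ ↦ g (ι (transFun (transFun (fun _ ↦ Ja.Kout.base) ℓ) (fun _ ↦ Jb.Kin.base) θ))) θ) := by
  intro εc Φ' Ψ'
  have hI : ∀ {a b : ℝ}, a ≤ b → Ioo (τ₀ - a) (τ₀ + a) ⊆ Ioo (τ₀ - b) (τ₀ + b) := fun h ↦
    Ioo_subset_Ioo (by linarith) (by linarith)
  /- the gate at the junction `Ja` -/
  have hηg : 0 < D.icRadius Ja.hv χa hχa := D.icRadius_pos Ja.hv χa hχa
  have hηgχ := D.icRadius_spec Ja.hv χa hχa
  have hG := D.isFenceOn_gateFence Ja.hv (j := Ja.jin) (j' := Ja.jout) hηg hχa hηgχ Ja.hβ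
  /- the common radius -/
  have hεe := E.ε_pos
  have hεcpos : 0 < εc := lt_min hε (lt_min (by linarith) hεe)
  have hεcε : εc ≤ ε := min_le_left _ _
  have hεcg : εc ≤ D.icRadius Ja.hv χa hχa / 4 := (min_le_right _ _).trans (min_le_left _ _)
  have hεce : εc ≤ E.ε := (min_le_right _ _).trans (min_le_right _ _)
  /- the concatenations -/
  have hj₁ : ∀ τ ∈ Ioo (τ₀ - εc) (τ₀ + εc), Φ 1 τ = D.gateFence Ja.hv Ja.jin Ja.jout Ja.β χa 0 τ :=
    fun τ hτ ↦ by rw [hΦ1 τ (hI hεcε hτ), gateFence_zero]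
  have h1 := IsFenceOn.trans (hΦ.mono Subset.rfl hεcε) (hG.mono Subset.rfl hεcg) hj₁ (half_pos hεcpos) (by linarith)
  have hj₂ : ∀ τ ∈ Ioo (τ₀ - εc / 2) (τ₀ + εc / 2),
      transFence Φ (D.gateFence Ja.hv Ja.jin Ja.jout Ja.β χa) 1 τ = E.Φ 0 τ := fun τ hτ ↦ by
    have hτe : τ ∈ Ioo (τ₀ - E.ε) (τ₀ + E.ε) := hI (by linarith) hτ
    rw [transFence_one, gateFence_one, E.Φ_eq, E.Ψ_zero τ hτe, E.ι_T₁ τ hτe]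
  have h2 := IsFenceOn.trans h1 (E.isFenceOn.mono Subset.rfl (show εc / 2 ≤ E.ε by linarith)) hj₂
    (show (0 : ℝ) < εc / 4 by linarith) (by linarith)
  refine ⟨by linarith, by linarith, h2, fun τ ↦ ?_, fun τ ↦ ?_, fun τ hτ ↦ ?_, fun τ hτ hsτ ↦ ?_, fun θ ↦ ?_⟩
  · show transFence (transFence Φ _) E.Φ 0 τ = Φ 0 τ
    rw [transFence_zero, transFence_zero]
  · show transFence (transFence Ψ _) E.Ψ 0 τ = Ψ 0 τ
    rw [transFence_zero, transFence_zero]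
  · have hτe : τ ∈ Ioo (τ₀ - E.ε) (τ₀ + E.ε) := hI (by linarith) hτ
    show transFence (transFence Φ _) E.Φ 1 τ = _
    rw [transFence_one, E.Φ_eq, E.Ψ_one τ hτe, E.ι_T₁' τ hτe]
  · -- the planar description on the side `s`
    have hτε : τ ∈ Ioo (τ₀ - ε) (τ₀ + ε) := hI (by linarith) hτ
    have hτe : τ ∈ Ioo (τ₀ - E.ε) (τ₀ + E.ε) := hI (by linarith) hτ
    have hτg : τ ∈ Ioo (τ₀ - D.icRadius Ja.hv χa hχa) (τ₀ + D.icRadius Ja.hv χa hχa) := hI (by linarith) hτ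
    obtain ⟨hIHΦ, hIHcont, hIH1⟩ := htrack τ hτε hsτ
    obtain ⟨hspos, hne0⟩ := orderIso_sign χa hχa hs hsτ
    have hnb : Ja.jout = (D.star Ja.v Ja.hv).nb Ja.jin (χa τ) := by
      rw [hturn]; exact (Ja.nb_eq_turn hs hspos).symm
    have hgate := D.gateFence_eq_of_nb hι Ja.hv (j := Ja.jin) (j' := Ja.jout) Ja.hβ (hηgχ τ hτg) hne0 hnb
    have hgcont := D.continuous_toLeafSpace_gateΨ hι Ja.hv (j := Ja.jin) (j' := Ja.jout) (β₀ := Ja.β)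
      Ja.hβ (hηgχ τ hτg) hne0 hnb
    refine ⟨fun θ ↦ ?_, ?_, ?_, E.ι_T₁' τ hτe⟩
    · show transFence (transFence Φ (D.gateFence Ja.hv Ja.jin Ja.jout Ja.β χa)) E.Φ θ τ =
        (g ∘ ι) (transFence (transFence Ψ (D.gateΨ hι Ja.hv Ja.jin Ja.jout Ja.β χa)) E.Ψ θ τ)
      simp only [← transFence_map (g ∘ ι)]
      refine transFence_congr (fun θ' ↦ transFence_congr (fun θ'' ↦ ?_) (fun θ'' ↦ ?_) θ') (fun θ' ↦ ?_) θ
      · exact hIHΦ θ''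
      · exact hgate θ''
      · exact E.Φ_eq θ' τ
    · show Continuous fun θ ↦ toLeafSpace (transFence (transFence Ψ (D.gateΨ hι Ja.hv Ja.jin Ja.jout Ja.β χa)) E.Ψ θ τ)
      simp only [← transFence_map (toLeafSpace : X → F.LeafSpace)]
      refine continuous_transFence_apply (continuous_transFence_apply hIHcont hgcont ?_) (E.continuous_toLeafSpace τ hτe) ?_
      · show toLeafSpace (Ψ 1 τ) = toLeafSpace (D.gateΨ hι Ja.hv Ja.jin Ja.jout Ja.β χa 0 τ)
        rw [hIH1, gateΨ_zero]; rfl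
      · rw [transFence_one]
        show toLeafSpace (D.gateΨ hι Ja.hv Ja.jin Ja.jout Ja.β χa 1 τ) = toLeafSpace (E.Ψ 0 τ)
        rw [gateΨ_one, E.Ψ_zero τ hτe]; rfl
    · show transFence (transFence Ψ _) E.Ψ 1 τ = _
      rw [transFence_one]; exact E.Ψ_one τ hτe
  · -- the base level
    show transFence (transFence Φ (D.gateFence Ja.hv Ja.jin Ja.jout Ja.β χa)) E.Φ θ τ₀ = _
    simp only [transFence_apply_eq_transFun]
    refine transFun_congr (fun θ' ↦ transFun_congr (fun θ'' ↦ rfl) (fun θ'' ↦ ?_) θ') (fun θ' ↦ ?_) θ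
    · exact Ja.gateFence_base χa hχa θ''
    · show E.Φ θ' τ₀ = g (ι (transFun (transFun (fun _ ↦ Ja.Kout.base) ℓ) (fun _ ↦ Jb.Kin.base) θ'))
      rw [E.Φ_eq, E.Ψ_base]

/-! ## The walk fence, defined by recursion -/

section Walk

variable (ho : F.IsTransverselyOriented) (J : ℕ → D.WalkJunction hι)
  (ℓ : ∀ k, Path (J k).Kout.base (J (k + 1)).Kin.base) (hℓ : ∀ k, Continuous (toLeafSpace ∘ ℓ k : I → F.LeafSpace))
  {s : ℝ} (hs : s = 1 ∨ s = -1) (hturn : ∀ k, (J k).jout = (J k).turn s)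

/-- **The data and properties of a walk fence** over the walk up to the junction `n`: a level
conversion `χ` at the end, a level radius, a germ path from the initial germ of `J 0` to the
junction germ at the incoming prong point of `J n`, the fence `Φ` and its planar description `Ψ`;
`Φ` starts on the star vertical of `J 0` on the plaques of `box v₀`, ends on the star vertical of
`J n` converted by `χ`, its horizontals on the side `s` are images of the planar leaf paths
`Ψ(·, τ)` between the points of the two star verticals, and its base horizontal is `walkBase`.
[folklore] -/
structure WalkFenceData (s : ℝ) (n : ℕ) where
  /-- the level conversion at the end -/
  χ : ℝ ≃o ℝ
  /-- the level radius -/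
  ε : ℝ
  /-- the germ path -/
  Γ : Path (J 0).start (D.sectorGerm (J n).hv (J n).jin (J n).β 0 χ (J 0).τ₀ 0)
  /-- the fence -/
  Φ : I → ℝ → M
  /-- the planar description -/
  Ψ : I → ℝ → X
  χ_apply : χ (J 0).τ₀ = 0
  ε_pos : 0 < ε
  isFenceOn : IsFenceOn T Γ (J 0).τ₀ ε Φ univ
  Φ_zero : ∀ τ ∈ Ioo ((J 0).τ₀ - ε) ((J 0).τ₀ + ε),
    Φ 0 τ = g ((D.star (J 0).v (J 0).hv).pt (J 0).jin ((J 0).β, (J 0).χ₀ τ))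
  Φ_one : ∀ τ ∈ Ioo ((J 0).τ₀ - ε) ((J 0).τ₀ + ε), Φ 1 τ = g ((D.star (J n).v (J n).hv).pt (J n).jin ((J n).β, χ τ))
  Φ_zero_mem : ∀ τ ∈ Ioo ((J 0).τ₀ - ε) ((J 0).τ₀ + ε), Φ 0 τ ∈ plaque (D.box (J 0).v) τ
  track : ∀ τ ∈ Ioo ((J 0).τ₀ - ε) ((J 0).τ₀ + ε), 0 < s * (τ - (J 0).τ₀) →
    (∀ θ, Φ θ τ = g (ι (Ψ θ τ))) ∧ Continuous (toLeafSpace ∘ fun θ ↦ Ψ θ τ : I → F.LeafSpace) ∧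
    Ψ 0 τ = (J 0).Kin.T₁ (J 0).χ₀ τ ∧ Ψ 1 τ = (J n).Kin.T₁ χ τ ∧
    ι ((J 0).Kin.T₁ (J 0).χ₀ τ) = (D.star (J 0).v (J 0).hv).pt (J 0).jin ((J 0).β, (J 0).χ₀ τ) ∧
    ι ((J n).Kin.T₁ χ τ) = (D.star (J n).v (J n).hv).pt (J n).jin ((J n).β, χ τ)
  Φ_base : ∀ θ, Φ θ (J 0).τ₀ = D.walkBase J ℓ n θ

variable {J ℓ}

/-- **The walk fence over the empty walk.** [folklore] -/
def WalkFenceData.zero (s : ℝ) : WalkFenceData J ℓ s 0 where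
  χ := (J 0).χ₀
  ε := (J 0).baseRadius
  Γ := (J 0).basePath
  Φ := (J 0).baseFence
  Ψ := fun _ τ ↦ (J 0).Kin.T₁ (J 0).χ₀ τ
  χ_apply := (J 0).χ₀_τ₀
  ε_pos := (J 0).baseRadius_pos
  isFenceOn := (J 0).isFenceOn_base
  Φ_zero := fun τ _ ↦ (J 0).baseFence_apply 0 τ
  Φ_one := fun τ _ ↦ (J 0).baseFence_apply 1 τ
  Φ_zero_mem := fun _ hτ ↦ (J 0).baseFence_mem_plaque hτ
  track := fun τ hτ _ ↦ ⟨fun θ ↦ by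
      show (J 0).baseFence θ τ = g (ι ((J 0).Kin.T₁ (J 0).χ₀ τ))
      rw [(J 0).baseFence_apply, (J 0).ι_T₁_χ₀ hτ], continuous_const, rfl, rfl, (J 0).ι_T₁_χ₀ hτ, (J 0).ι_T₁_χ₀ hτ⟩
  Φ_base := fun θ ↦ by
    show (J 0).baseFence θ (J 0).τ₀ = g ((D.star (J 0).v (J 0).hv).pt (J 0).jin ((J 0).β, 0))
    rw [(J 0).baseFence_apply, (J 0).χ₀_τ₀]

/-- The chosen edge fence after the walk fence `W`, over the link `ℓ n`. [folklore] -/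
def WalkFenceData.edge {n : ℕ} (W : WalkFenceData J ℓ s n) :
    D.EdgeFence hι (J n).hv (J n).Kout (J (n + 1)).hv (J (n + 1)).Kin (ℓ n) W.χ (J 0).τ₀ :=
  D.edgeFence hι (J n).hv (J n).Kout ho (J n).hβ (J (n + 1)).hv (J (n + 1)).Kin (J (n + 1)).hβ (ℓ n) (hℓ n) W.χ W.χ_apply

/-- The level radius of the extended walk fence, before division by `4`. [folklore] -/
def WalkFenceData.succRadius {n : ℕ} (W : WalkFenceData J ℓ s n) : ℝ :=
  min W.ε (min (D.icRadius (J n).hv W.χ W.χ_apply / 4) (W.edge ho hℓ).ε)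

/-- **The walk fence extended by the gate of `J n` and the edge fence over `ℓ n`.** [folklore] -/
def WalkFenceData.succ {n : ℕ} (W : WalkFenceData J ℓ s n) : WalkFenceData J ℓ s (n + 1) :=
  have h := D.walkFence_step hs (J n) (J (n + 1)) (hturn n) (ℓ n) W.χ W.χ_apply W.ε_pos W.Γ W.isFenceOn W.Φ_one
    (fun τ hτ hsτ ↦ ⟨(W.track τ hτ hsτ).1, (W.track τ hτ hsτ).2.1, (W.track τ hτ hsτ).2.2.2.1⟩) (W.edge ho hℓ)
  have hε4 : W.succRadius ho hℓ / 4 ≤ W.ε := h.2.1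
  have hI : Ioo ((J 0).τ₀ - W.succRadius ho hℓ / 4) ((J 0).τ₀ + W.succRadius ho hℓ / 4) ⊆
      Ioo ((J 0).τ₀ - W.ε) ((J 0).τ₀ + W.ε) :=
    Ioo_subset_Ioo (by linarith) (by linarith)
  { χ := (W.edge ho hℓ).χ'
    ε := W.succRadius ho hℓ / 4
    Γ := (W.Γ.trans (D.gatePath (J n).hv W.χ_apply (J n).hβ)).trans (W.edge ho hℓ).Γ
    Φ := transFence (transFence W.Φ (D.gateFence (J n).hv (J n).jin (J n).jout (J n).β W.χ)) (W.edge ho hℓ).Φ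
    Ψ := transFence (transFence W.Ψ (D.gateΨ hι (J n).hv (J n).jin (J n).jout (J n).β W.χ)) (W.edge ho hℓ).Ψ
    χ_apply := (W.edge ho hℓ).χ'_apply
    ε_pos := h.1
    isFenceOn := h.2.2.1
    Φ_zero := fun τ hτ ↦ by rw [h.2.2.2.1]; exact W.Φ_zero τ (hI hτ)
    Φ_one := h.2.2.2.2.2.1
    Φ_zero_mem := fun τ hτ ↦ by rw [h.2.2.2.1]; exact W.Φ_zero_mem τ (hI hτ)
    track := fun τ hτ hsτ ↦ by
      obtain ⟨h₁, h₂, h₃, h₄⟩ := h.2.2.2.2.2.2.1 τ hτ hsτ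
      obtain ⟨-, -, h₅, -, h₆, -⟩ := W.track τ (hI hτ) hsτ
      exact ⟨h₁, h₂, by rw [h.2.2.2.2.1]; exact h₅, h₃, h₆, h₄⟩
    Φ_base := fun θ ↦ by
      rw [h.2.2.2.2.2.2.2 θ]
      show _ = transFun (transFun (D.walkBase J ℓ n) (J n).gateBase)
        (fun θ ↦ g (ι (transFun (transFun (fun _ ↦ (J n).Kout.base) (ℓ n)) (fun _ ↦ (J (n + 1)).Kin.base) θ))) θ
      exact transFun_congr (fun θ' ↦ transFun_congr (fun θ'' ↦ W.Φ_base θ'') (fun _ ↦ rfl) θ') (fun _ ↦ rfl) θ }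

/-- **The walk fence** over the walk up to the junction `n`, defined by recursion. See
`WalkFenceData`. [cite: CamachoLinsNeto1985, Ch. VII §2] -/
def walkFence : (n : ℕ) → WalkFenceData J ℓ s n
  | 0 => WalkFenceData.zero s
  | n + 1 => (walkFence n).succ ho hℓ hs hturn

/-- The walk fence over the empty walk. [folklore] -/
@[simp] theorem walkFence_zero : D.walkFence ho hℓ hs hturn 0 = WalkFenceData.zero (J := J) (ℓ := ℓ) s := rfl

/-- The walk fence up to `n + 1` is the extension of the walk fence up to `n`. [folklore] -/
@[simp] theorem walkFence_succ (n : ℕ) :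
    D.walkFence ho hℓ hs hturn (n + 1) = (D.walkFence ho hℓ hs hturn n).succ ho hℓ hs hturn := rfl

/-- **The normal form of the walk fence at its start**, for the transport of null-homotopy: the
initial germ is the height germ of `box v₀` and its base point lies on the plaque of the base
level. [folklore] -/
theorem walkFence_start (n : ℕ) :
    ((D.walkFence ho hℓ hs hturn n).Γ 0).germ = ↑(height (D.box (J 0).v)) ∧
      ofLeafSpace ((D.walkFence ho hℓ hs hturn n).Γ 0).pt ∈ plaque (D.box (J 0).v) (J 0).τ₀ := by
  rw [(D.walkFence ho hℓ hs hturn n).Γ.source]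
  exact ⟨(J 0).start_germ, (J 0).start_pt_mem⟩

end Walk

end StarData

end Literature.Topology.PlanarFoliations
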